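import Literature.MathematicalPhysics.QuantumLattice.Phi4BoxGaussianBounds
import HarnessLib

/-!
# Volume monotonicity, a-priori bounds and the thermodynamic limit of the lattice `φ⁴` two-point function

Proofs-only file (topic `Literature/MathematicalPhysics/QuantumLattice`; theorems only, no definition,
no named fact). Fourth step of the `φ⁴` line of Aizenman–Duminil-Copin 2021 in the tree's vocabulary
(after `GriffithsSimonApproximation`, `Phi4NewmanGaussianInequality`, `Phi4BoxGaussianBounds`), and
the "next brick" announced in `LatticeScalarFieldGriffithsProofs` ("monotonicity in the volume for the
free-boundary `φ⁴` measures on `ℤᵈ` (needs edge-dependent couplings), the thermodynamic limit of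
`phi4TwoPointIn`"): the existence of "the states' natural infinite volume limit" `⟨·⟩_{ρ,β}`
(ADC 2021, §5, p. 16) for the two-point function of the free-boundary lattice `φ⁴` model on `ℤᵈ`,
for **every** `g > 0`, `κ ∈ ℝ`, `J ≥ 0`.

## Contents

1. Plumbing for Lebesgue measure on `V → ℝ` (`V` finite): reindexing along an equivalence of index
   types (`integral_comp_equiv_index`), the linear change of variables
   `∫ F(Tφ) dφ = |det T|⁻¹ ∫ F` (`integral_comp_linearMap_of_det_ne_zero`), splitting the
   coordinates by a predicate (`integral_pi_mul_split`).
2. **An a-priori bound on `⟨φₓ²⟩` uniform in the volume** (`phi4_sq_moment_le`): on any finite graph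
   with degrees `≤ Δ`, `⟨φₓ²⟩_{G;g,κ,J} ≤ max 1 (16 (1 + |κ| + J Δ) / (15 g))`. Proof ("equation of
   motion" by dilation, derivative-free): scaling the single coordinate `φₓ ↦ t φₓ` in the partition
   function gives `⟨e^{-W_t}⟩ = 1/t` with `S(T_t φ) = S(φ) + W_t(φ)`; `e^{-w} ≥ 1 - w` at `t = 1/2`
   yields `(15/16) g ⟨φₓ⁴⟩ ≤ 1 - (3/4) κ ⟨φₓ²⟩ + (J/2) ∑_{y∼x} ⟨φₓφ_y⟩`, and `⟨φₓ²⟩² ≤ ⟨φₓ⁴⟩`.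
3. **Monotonicity of the two-point function in the volume** (Glimm–Jaffe 1987, §4.2, consequence
   of Prop. 4.2.1 / Griffiths' second inequality: adding ferromagnetic bonds increases `⟨φ_A⟩`;
   decoupled sites factor off): invariance of `phi4Measure` expectations under graph isomorphisms
   (`integral_phi4Measure_iso`), factorisation over decoupled vertices
   (`phi4_twoPoint_eq_comap_subtype`), monotonicity under adding edges (`phi4_twoPoint_mono_edges`), and
   for the free-boundary volumes of `ℤᵈ`: `phi4TwoPointIn_mono_volume`
   (`Λ ⊆ Λ' ⇒ ⟨φₓφ_y⟩_Λ ≤ ⟨φₓφ_y⟩_{Λ'}`).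
4. **The thermodynamic limit** (Friedli–Velenik 2017, §3.7.4 road for Ising, here for `φ⁴`): the
   infinite-volume two-point function `⨆_Λ ⟨φₓφ_y⟩_Λ` is the limit along every increasing exhausting
   sequence of volumes (`tendsto_phi4TwoPointIn_iSup`), in particular along boxes
   (`hasBoxLimit_phi4TwoPointIn`, `phi4TwoPoint_eq_iSup`), with `0 ≤ ⨆_Λ ⟨φₓφ_y⟩_Λ ≤ B(g,κ,J,d)`.
5. **Translation invariance** of the infinite-volume two-point function
   (`iSup_phi4TwoPointIn_shift`).

## References

* J. Glimm, A. Jaffe, *Quantum Physics* (2nd ed., Springer 1987), §4.2, Prop. 4.2.1 (monotonicity of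
  `⟨ξ^B⟩` in the couplings `J_A`) and its use for the infinite-volume limit, p. 57; §9.5
  [GlimmJaffeQP1987] (held, read pp. 55–57).
* S. Friedli, Y. Velenik, *Statistical Mechanics of Lattice Systems* (CUP 2017), §3.7.4 and
  Exercise 3.12 (free-boundary correlations are nondecreasing in the volume; thermodynamic limit
  along boxes) [FriedliVelenik2017].
* M. Aizenman, H. Duminil-Copin, Ann. of Math. 194 (2021), arXiv:1912.07973, §5 (p. 16:
  `⟨·⟩_{Λ,ρ,β}`, "the states' natural infinite volume limit" `⟨·⟩_{ρ,β}`) [AizenmanDuminilCopinAnnals2021].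

## Design

No definition is introduced: the infinite-volume two-point function is written
`⨆ Λ : Finset (Site d), phi4TwoPointIn d Λ g κ J x y` throughout (it is bounded by item 2), and the
tree's junk-valued `phi4TwoPoint d g κ J x = boxLim …` is identified with it (`phi4TwoPoint_eq_iSup`).
The a-priori bound is stated with an explicit (non-optimised) constant.
-/

noncomputable section

open MeasureTheory Filter Topology Finset MvPolynomial
open Literature.Probability.LatticeModels

namespace Literature.MathematicalPhysics.QuantumLattice

/-! ### 1. Plumbing: reindexing, linear change of variables, splitting coordinates -/

section Plumbing

/-- Reindexing the coordinates along an equivalence of (finite) index types preserves Lebesgue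
integrals: `∫ F(ψ ∘ e) dψ = ∫ F(χ) dχ`. [folklore] -/
theorem integral_comp_equiv_index {α β : Type*} [Fintype α] [Fintype β] (e : α ≃ β)
    (F : (α → ℝ) → ℝ) : ∫ ψ : β → ℝ, F (fun a => ψ (e a)) = ∫ χ : α → ℝ, F χ := by
  have h := volume_measurePreserving_piCongrLeft (fun _ : α => ℝ) e.symm
  have hfun : ∀ ψ : β → ℝ,
      (MeasurableEquiv.piCongrLeft (fun _ : α => ℝ) e.symm) ψ = fun a => ψ (e a) := by
    intro ψ
    funext a
    rw [MeasurableEquiv.coe_piCongrLeft, Equiv.piCongrLeft_apply, eq_rec_constant,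
      Equiv.symm_symm]
  rw [← h.integral_comp']
  simp_rw [hfun]

/-- Integrability is invariant under reindexing the coordinates. [folklore] -/
theorem integrable_comp_equiv_index_iff {α β : Type*} [Fintype α] [Fintype β] (e : α ≃ β)
    (F : (α → ℝ) → ℝ) :
    Integrable (fun ψ : β → ℝ => F (fun a => ψ (e a))) ↔ Integrable F := by
  have h := volume_measurePreserving_piCongrLeft (fun _ : α => ℝ) e.symm
  have hfun : (fun ψ : β → ℝ => F (fun a => ψ (e a))) =
      F ∘ (MeasurableEquiv.piCongrLeft (fun _ : α => ℝ) e.symm) := by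
    funext ψ
    simp only [Function.comp_apply]
    congr 1
    funext a
    rw [MeasurableEquiv.coe_piCongrLeft, Equiv.piCongrLeft_apply, eq_rec_constant,
      Equiv.symm_symm]
  rw [hfun]
  exact h.integrable_comp_emb (MeasurableEquiv.measurableEmbedding _)

variable {V : Type*} [Fintype V]

/-- **Linear change of variables** for Lebesgue measure on `V → ℝ`: for a linear map `T` with
`det T ≠ 0`, `∫ F(Tφ) dφ = |det T|⁻¹ ∫ F(φ) dφ` (Mathlib's
`Measure.map_linearMap_addHaar_eq_smul_addHaar`). [folklore] -/
theorem integral_comp_linearMap_of_det_ne_zero (T : (V → ℝ) →ₗ[ℝ] (V → ℝ))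
    (hT : LinearMap.det T ≠ 0) (F : (V → ℝ) → ℝ) :
    ∫ φ, F (T φ) = |(LinearMap.det T)⁻¹| * ∫ φ, F φ := by
  have hemb : MeasurableEmbedding (T : (V → ℝ) → (V → ℝ)) :=
    (LinearMap.equivOfDetNeZero T hT).toContinuousLinearEquiv.toHomeomorph.measurableEmbedding
  rw [← hemb.integral_map, Measure.map_linearMap_addHaar_eq_smul_addHaar _ hT,
    integral_smul_measure, ENNReal.toReal_ofReal (abs_nonneg _), smul_eq_mul]

/-- Integrability after a linear change of variables with `det T ≠ 0`. [folklore] -/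
theorem integrable_comp_linearMap_iff_of_det_ne_zero (T : (V → ℝ) →ₗ[ℝ] (V → ℝ))
    (hT : LinearMap.det T ≠ 0) (F : (V → ℝ) → ℝ) :
    Integrable (fun φ => F (T φ)) ↔ Integrable F := by
  have hemb : MeasurableEmbedding (T : (V → ℝ) → (V → ℝ)) :=
    (LinearMap.equivOfDetNeZero T hT).toContinuousLinearEquiv.toHomeomorph.measurableEmbedding
  change Integrable (F ∘ T) volume ↔ _
  rw [← hemb.integrable_map_iff, Measure.map_linearMap_addHaar_eq_smul_addHaar _ hT,
    integrable_smul_measure (by simp [hT]) ENNReal.ofReal_ne_top]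

/-- **Splitting the coordinates by a predicate**: for Lebesgue measure on `V → ℝ`,
`∫ F(φ|_{p}) K(φ|_{¬p}) dφ = (∫ F)(∫ K)` (Mathlib's `measurePreserving_piEquivPiSubtypeProd` and
Fubini). [folklore] -/
theorem integral_pi_mul_split (p : V → Prop) [DecidablePred p]
    (F : ({u // p u} → ℝ) → ℝ) (K : ({u // ¬p u} → ℝ) → ℝ) :
    ∫ φ : V → ℝ, F (fun u => φ u) * K (fun u => φ u) =
      (∫ ψ : {u // p u} → ℝ, F ψ) * ∫ χ : {u // ¬p u} → ℝ, K χ := by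
  have h := volume_preserving_piEquivPiSubtypeProd (fun _ : V => ℝ) p
  have h2 := h.integral_comp' (g := fun z : ({u // p u} → ℝ) × ({u // ¬p u} → ℝ) => F z.1 * K z.2)
  simp only [MeasurableEquiv.piEquivPiSubtypeProd_apply] at h2
  rw [h2]
  exact integral_prod_mul F K

end Plumbing

/-! ### 2. An a-priori bound on `⟨φₓ²⟩`, uniform in the volume -/

section APriori

variable {V : Type*} [Fintype V] [DecidableEq V] (G : SimpleGraph V) [DecidableRel G.Adj]

omit [DecidableEq V] in
/-- The pair interaction as half a sum over ordered adjacent pairs: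
`∑_{xy ∈ E(G)} φₓφ_y = ½ ∑ₓ ∑_y [x ∼ y] φₓ φ_y`. [folklore] -/
theorem pairInteraction_eq_half_sum_adj (φ : V → ℝ) :
    pairInteraction G φ = 1 / 2 * ∑ x, ∑ y, if G.Adj x y then φ x * φ y else 0 := by
  classical
  have h := mul_pairInteraction_eq_half_sum_adj G 1 φ
  rw [one_mul] at h
  rw [h]

/-- Effect of changing one coordinate on the sum over ordered adjacent pairs:
`∑∑ [u∼v] ψ_u ψ_v = ∑∑ [u∼v] φ_u φ_v + 2 (a - φₓ) ∑_{v ∼ x} φ_v` for `ψ = (φ with φₓ ↦ a)` (no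
diagonal term since `G` is loopless). [folklore] -/
theorem sum_adj_update (x : V) (a : ℝ) (φ : V → ℝ) :
    ∑ u, ∑ v, (if G.Adj u v then Function.update φ x a u * Function.update φ x a v else 0) =
      ∑ u, ∑ v, (if G.Adj u v then φ u * φ v else 0) +
        2 * (a - φ x) * ∑ v ∈ Finset.univ.filter (G.Adj x), φ v := by
  have key : ∀ u v, (if G.Adj u v then Function.update φ x a u * Function.update φ x a v else 0) =
      (if G.Adj u v then φ u * φ v else 0) +
        ((if u = x then (if G.Adj u v then (a - φ x) * φ v else 0) else 0) +
          (if v = x then (if G.Adj u v then (a - φ x) * φ u else 0) else 0)) := by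
    intro u v
    by_cases huv : G.Adj u v
    · have hne : u ≠ v := G.ne_of_adj huv
      by_cases hu : u = x
      · subst hu
        have hv : v ≠ u := fun h => hne h.symm
        simp [huv, hv]
        ring
      · by_cases hv : v = x
        · subst hv
          simp [huv, hu]
          ring
        · simp [huv, hu, hv]
    · simp [huv]
  simp_rw [key, Finset.sum_add_distrib]
  have hB : ∑ u, ∑ v, (if u = x then (if G.Adj u v then (a - φ x) * φ v else 0) else 0) =
      (a - φ x) * ∑ v ∈ Finset.univ.filter (G.Adj x), φ v := by
    rw [Finset.sum_eq_single x (fun u _ hu => by simp [hu]) (fun h => absurd (Finset.mem_univ x) h)]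
    simp only [if_true]
    rw [Finset.sum_filter, Finset.mul_sum]
    refine Finset.sum_congr rfl fun v _ => ?_
    split_ifs <;> ring
  have hC : ∑ u, ∑ v, (if v = x then (if G.Adj u v then (a - φ x) * φ u else 0) else 0) =
      (a - φ x) * ∑ v ∈ Finset.univ.filter (G.Adj x), φ v := by
    rw [Finset.sum_comm,
      Finset.sum_eq_single x (fun u _ hu => by simp [hu]) (fun h => absurd (Finset.mem_univ x) h)]
    simp only [if_true]
    rw [Finset.sum_filter, Finset.mul_sum]
    refine Finset.sum_congr rfl fun v _ => ?_
    simp only [G.adj_comm v x]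
    split_ifs <;> ring
  rw [hB, hC]
  ring

/-- **One-coordinate dilation of the `φ⁴` action**: with `ψ = (φ with φₓ ↦ t φₓ)`,
`S(ψ) = S(φ) + W_t(φ)`, `W_t = g(t⁴-1)φₓ⁴ + κ(t²-1)φₓ² - J(t-1) φₓ ∑_{y∼x} φ_y`. [folklore] -/
theorem phi4Action_update_mul (g κ J t : ℝ) (x : V) (φ : V → ℝ) :
    phi4Action G g κ J (Function.update φ x (t * φ x)) = phi4Action G g κ J φ +
      (g * (t ^ 4 - 1) * φ x ^ 4 + κ * (t ^ 2 - 1) * φ x ^ 2 -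
        J * (t - 1) * (φ x * ∑ y ∈ Finset.univ.filter (G.Adj x), φ y)) := by
  have hsite : ∑ i, (g * Function.update φ x (t * φ x) i ^ 4 + κ * Function.update φ x (t * φ x) i ^ 2)
      = ∑ i, (g * φ i ^ 4 + κ * φ i ^ 2) + (g * (t ^ 4 - 1) * φ x ^ 4 + κ * (t ^ 2 - 1) * φ x ^ 2) := by
    have hfun : (fun i => g * Function.update φ x (t * φ x) i ^ 4 + κ * Function.update φ x (t * φ x) i ^ 2)
        = Function.update (fun i => g * φ i ^ 4 + κ * φ i ^ 2) x (g * (t * φ x) ^ 4 + κ * (t * φ x) ^ 2) := by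
      funext i
      by_cases hi : i = x
      · subst hi; simp
      · simp [hi]
    rw [hfun, Finset.sum_update_of_mem (Finset.mem_univ x),
      Finset.sum_eq_add_sum_sdiff_singleton_of_mem (Finset.mem_univ x) (fun i => g * φ i ^ 4 + κ * φ i ^ 2)]
    ring
  have hpair : pairInteraction G (Function.update φ x (t * φ x)) =
      pairInteraction G φ + (t - 1) * (φ x * ∑ y ∈ Finset.univ.filter (G.Adj x), φ y) := by
    rw [pairInteraction_eq_half_sum_adj, pairInteraction_eq_half_sum_adj, sum_adj_update]
    ring
  unfold phi4Action
  rw [hsite, hpair]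
  ring

/-- The one-coordinate dilation `φ ↦ (φ with φₓ ↦ t φₓ)` is the linear map of the diagonal matrix
`diag(1,…,t,…,1)`. [folklore] -/
theorem toLin'_diagonal_update_apply (x : V) (t : ℝ) (φ : V → ℝ) :
    Matrix.toLin' (Matrix.diagonal (Function.update (1 : V → ℝ) x t)) φ =
      Function.update φ x (t * φ x) := by
  funext i
  rw [Matrix.toLin'_apply, Matrix.mulVec_diagonal]
  by_cases h : i = x
  · subst h; simp
  · simp [h]

/-- Its determinant is `t`. [folklore] -/
theorem det_toLin'_diagonal_update (x : V) (t : ℝ) :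
    LinearMap.det (Matrix.toLin' (Matrix.diagonal (Function.update (1 : V → ℝ) x t))) = t := by
  rw [LinearMap.det_toLin', Matrix.det_diagonal, Finset.prod_update_of_mem (Finset.mem_univ x)]
  simp

omit [DecidableEq V] in
/-- Monomials `φ_u^k φ_v^l` are integrable under the lattice `φ⁴` measure (`g > 0`). [cite: GlimmJaffeQP1987, §4.1 (4.1.4)] -/
theorem integrable_pow_mul_pow_phi4Measure {g : ℝ} (hg : 0 < g) (κ J : ℝ) (u v : V) (k l : ℕ) :
    Integrable (fun φ : V → ℝ => φ u ^ k * φ v ^ l) (phi4Measure G g κ J) := by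
  classical
  refine integrable_phi4Measure_of_abs_le G hg κ J (by fun_prop) (C := 1) (b := k + l) fun φ => ?_
  rw [abs_mul, abs_pow, abs_pow, one_mul, add_mul, Real.exp_add]
  have hsq : ∀ w : V, (φ w) ^ 2 ≤ ∑ z, φ z ^ 2 := fun w =>
    Finset.single_le_sum (fun z _ => sq_nonneg (φ z)) (Finset.mem_univ w)
  refine mul_le_mul ?_ ?_ (pow_nonneg (abs_nonneg _) _) (Real.exp_nonneg _)
  · exact (abs_pow_le_exp_mul_sq (φ u) k).trans (Real.exp_le_exp.2
      (mul_le_mul_of_nonneg_left (hsq u) (Nat.cast_nonneg _)))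
  · exact (abs_pow_le_exp_mul_sq (φ v) l).trans (Real.exp_le_exp.2
      (mul_le_mul_of_nonneg_left (hsq v) (Nat.cast_nonneg _)))

omit [DecidableEq V] in
/-- `⟨φₓ²⟩² ≤ ⟨φₓ⁴⟩` under the (probability) lattice `φ⁴` measure. [folklore] -/
theorem sq_integral_sq_le_integral_pow_four {g : ℝ} (hg : 0 < g) (κ J : ℝ) (x : V) :
    (∫ φ, φ x ^ 2 ∂(phi4Measure G g κ J)) ^ 2 ≤ ∫ φ, φ x ^ 4 ∂(phi4Measure G g κ J) := by
  haveI := isProbabilityMeasure_phi4Measure_holds G hg κ J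
  set μ := phi4Measure G g κ J
  set m := ∫ φ, φ x ^ 2 ∂μ with hm
  have h2 : Integrable (fun φ : V → ℝ => φ x ^ 2) μ := by
    simpa using integrable_pow_mul_pow_phi4Measure G hg κ J x x 2 0
  have h4 : Integrable (fun φ : V → ℝ => φ x ^ 4) μ := by
    simpa using integrable_pow_mul_pow_phi4Measure G hg κ J x x 4 0
  have h0 : 0 ≤ ∫ φ, (φ x ^ 2 - m) ^ 2 ∂μ := integral_nonneg fun φ => sq_nonneg _
  have hI : Integrable (fun φ : V → ℝ => φ x ^ 4 - 2 * m * φ x ^ 2) μ := h4.sub (h2.const_mul _)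
  have hexp : ∫ φ, (φ x ^ 2 - m) ^ 2 ∂μ = (∫ φ, φ x ^ 4 ∂μ) - 2 * m * m + m ^ 2 := by
    have hfun : (fun φ : V → ℝ => (φ x ^ 2 - m) ^ 2) =
        fun φ => φ x ^ 4 - 2 * m * φ x ^ 2 + m ^ 2 := by
      funext φ; ring
    rw [hfun, integral_add hI (integrable_const _), integral_sub h4 (h2.const_mul _),
      integral_const_mul, integral_const]
    simp [hm]
  nlinarith [h0, hexp]

/-- **The dilation identity** `⟨e^{-W_t}⟩ = 1/t`, in the form
`∫ e^{-S ∘ T_t} dφ = t⁻¹ ∫ e^{-S} dφ` for `t > 0` (linear change of variables `φₓ ↦ tφₓ` in the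
partition function). [folklore] -/
theorem integral_exp_neg_dilation (g κ J : ℝ) {t : ℝ} (ht : 0 < t) (x : V) :
    ∫ φ : V → ℝ, Real.exp (-phi4Action G g κ J (Function.update φ x (t * φ x))) =
      t⁻¹ * ∫ φ : V → ℝ, Real.exp (-phi4Action G g κ J φ) := by
  have hdet := det_toLin'_diagonal_update x t
  have hne : LinearMap.det (Matrix.toLin' (Matrix.diagonal (Function.update (1 : V → ℝ) x t))) ≠ 0 := by
    rw [hdet]; exact ht.ne'
  have h := integral_comp_linearMap_of_det_ne_zero _ hne
    (fun φ => Real.exp (-phi4Action G g κ J φ))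
  simp only [toLin'_diagonal_update_apply] at h
  rw [h, hdet, abs_of_pos (inv_pos.2 ht)]

/-- Integrability of the dilated Boltzmann weight. [folklore] -/
theorem integrable_exp_neg_dilation {g : ℝ} (hg : 0 < g) (κ J : ℝ) {t : ℝ} (ht : 0 < t) (x : V) :
    Integrable (fun φ : V → ℝ => Real.exp (-phi4Action G g κ J (Function.update φ x (t * φ x)))) := by
  have hdet := det_toLin'_diagonal_update x t
  have hne : LinearMap.det (Matrix.toLin' (Matrix.diagonal (Function.update (1 : V → ℝ) x t))) ≠ 0 := by
    rw [hdet]; exact ht.ne'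
  have h := (integrable_comp_linearMap_iff_of_det_ne_zero _ hne
    (fun φ => Real.exp (-phi4Action G g κ J φ))).2 (integrable_exp_neg_phi4Action G hg κ J)
  simpa only [toLin'_diagonal_update_apply] using h

omit [DecidableEq V] in
/-- Polynomial growth is Gaussian-dominated: `|φₓ|^k ≤ e^{k ∑ φ²}` and
`|φₓ| |φ_y| ≤ e^{4 ∑ φ²}`-type bounds, packaged for the observables used below. [folklore] -/
theorem abs_pow_le_exp_four_sum (φ : V → ℝ) (x : V) {k : ℕ} (hk : k ≤ 4) :
    |φ x| ^ k ≤ Real.exp (4 * ∑ z, φ z ^ 2) := by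
  have hsq : (φ x) ^ 2 ≤ ∑ z, φ z ^ 2 :=
    Finset.single_le_sum (fun z _ => sq_nonneg (φ z)) (Finset.mem_univ x)
  refine (abs_pow_le_exp_mul_sq (φ x) k).trans (Real.exp_le_exp.2 ?_)
  have hk' : (k : ℝ) ≤ 4 := by exact_mod_cast hk
  have h0 : 0 ≤ ∑ z, φ z ^ 2 := Finset.sum_nonneg fun z _ => sq_nonneg (φ z)
  nlinarith [sq_nonneg (φ x)]

omit [DecidableEq V] in
/-- `|φₓ φ_y| ≤ e^{4 ∑ φ²}`. [folklore] -/
theorem abs_mul_le_exp_four_sum (φ : V → ℝ) (x y : V) :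
    |φ x * φ y| ≤ Real.exp (4 * ∑ z, φ z ^ 2) := by
  have hsq : ∀ w : V, (φ w) ^ 2 ≤ ∑ z, φ z ^ 2 := fun w =>
    Finset.single_le_sum (fun z _ => sq_nonneg (φ z)) (Finset.mem_univ w)
  have h0 : 0 ≤ ∑ z, φ z ^ 2 := Finset.sum_nonneg fun z _ => sq_nonneg (φ z)
  rw [abs_mul]
  have h1 : |φ x| * |φ y| ≤ ∑ z, φ z ^ 2 := by
    nlinarith [hsq x, hsq y, sq_abs (φ x), sq_abs (φ y), abs_nonneg (φ x), abs_nonneg (φ y),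
      sq_nonneg (|φ x| - |φ y|)]
  have h2 : ∑ z, φ z ^ 2 ≤ Real.exp (4 * ∑ z, φ z ^ 2) := by
    have h3 := Real.add_one_le_exp (∑ z, φ z ^ 2)
    have h4 : Real.exp (∑ z, φ z ^ 2) ≤ Real.exp (4 * ∑ z, φ z ^ 2) :=
      Real.exp_le_exp.2 (by nlinarith)
    linarith
  exact h1.trans h2

/-- **The equation-of-motion bound at `t = 1/2`**:
`(15/16) g ⟨φₓ⁴⟩ ≤ 1 - (3/4) κ ⟨φₓ²⟩ + (J/2) ∑_{y ∼ x} ⟨φₓ φ_y⟩` for the lattice `φ⁴` measure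
(`g > 0`), from `⟨e^{-W}⟩ = 2` and `e^{-w} ≥ 1 - w`. [folklore] -/
theorem phi4_pow_four_moment_le {g : ℝ} (hg : 0 < g) (κ J : ℝ) (x : V) :
    15 / 16 * g * ∫ φ, φ x ^ 4 ∂(phi4Measure G g κ J) ≤
      1 - 3 / 4 * κ * ∫ φ, φ x ^ 2 ∂(phi4Measure G g κ J) +
        J / 2 * ∑ y ∈ Finset.univ.filter (G.Adj x), ∫ φ, φ x * φ y ∂(phi4Measure G g κ J) := by
  haveI := isProbabilityMeasure_phi4Measure_holds G hg κ J
  set μ := phi4Measure G g κ J with hμ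
  set S := phi4Action G g κ J with hS
  set Z := ∫ φ : V → ℝ, Real.exp (-S φ) with hZ
  have hZpos : 0 < Z := phi4_partitionFunction_pos G hg κ J
  -- the observable `W = W_{1/2}` and its three pieces
  set N : Finset V := Finset.univ.filter (G.Adj x) with hN
  set W : (V → ℝ) → ℝ := fun φ => g * ((1 / 2 : ℝ) ^ 4 - 1) * φ x ^ 4 +
    κ * ((1 / 2 : ℝ) ^ 2 - 1) * φ x ^ 2 -
      J * ((1 / 2 : ℝ) - 1) * (φ x * ∑ y ∈ N, φ y) with hW
  have hSW : ∀ φ : V → ℝ, S (Function.update φ x ((1 / 2 : ℝ) * φ x)) = S φ + W φ := fun φ =>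
    phi4Action_update_mul G g κ J (1 / 2) x φ
  have hWcont : Continuous W := by
    simp only [hW]
    fun_prop
  have hWbound : ∀ φ : V → ℝ, |W φ| ≤ (g * |(1 / 2 : ℝ) ^ 4 - 1| + |κ| * |(1 / 2 : ℝ) ^ 2 - 1| +
      |J| * |(1 / 2 : ℝ) - 1| * Fintype.card V) * Real.exp (4 * ∑ z, φ z ^ 2) := by
    intro φ
    set E := Real.exp (4 * ∑ z, φ z ^ 2) with hE
    have hx4 : |φ x| ^ 4 ≤ E := abs_pow_le_exp_four_sum φ x le_rfl
    have hx2 : |φ x| ^ 2 ≤ E := abs_pow_le_exp_four_sum φ x (by norm_num)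
    have hsum : |φ x * ∑ y ∈ N, φ y| ≤ Fintype.card V * E := by
      rw [Finset.mul_sum]
      refine (Finset.abs_sum_le_sum_abs _ _).trans ?_
      refine (Finset.sum_le_sum fun y _ => abs_mul_le_exp_four_sum φ x y).trans ?_
      rw [Finset.sum_const, nsmul_eq_mul]
      refine mul_le_mul_of_nonneg_right ?_ (Real.exp_nonneg _)
      exact_mod_cast (Finset.card_filter_le _ _).trans (Finset.card_univ (α := V)).le
    have hA : |g * ((1 / 2 : ℝ) ^ 4 - 1) * φ x ^ 4| ≤ g * |(1 / 2 : ℝ) ^ 4 - 1| * E := by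
      rw [abs_mul, abs_mul, abs_pow, abs_of_pos hg]
      exact mul_le_mul_of_nonneg_left hx4 (mul_nonneg hg.le (abs_nonneg _))
    have hB : |κ * ((1 / 2 : ℝ) ^ 2 - 1) * φ x ^ 2| ≤ |κ| * |(1 / 2 : ℝ) ^ 2 - 1| * E := by
      rw [abs_mul, abs_mul, abs_pow]
      exact mul_le_mul_of_nonneg_left hx2 (mul_nonneg (abs_nonneg _) (abs_nonneg _))
    have hC : |J * ((1 / 2 : ℝ) - 1) * (φ x * ∑ y ∈ N, φ y)| ≤
        |J| * |(1 / 2 : ℝ) - 1| * (Fintype.card V * E) := by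
      rw [abs_mul, abs_mul]
      exact mul_le_mul_of_nonneg_left hsum (mul_nonneg (abs_nonneg _) (abs_nonneg _))
    have htri : |W φ| ≤ |g * ((1 / 2 : ℝ) ^ 4 - 1) * φ x ^ 4| + |κ * ((1 / 2 : ℝ) ^ 2 - 1) * φ x ^ 2| +
        |J * ((1 / 2 : ℝ) - 1) * (φ x * ∑ y ∈ N, φ y)| := by
      simp only [hW]
      exact (abs_sub _ _).trans (add_le_add (abs_add_le _ _) le_rfl)
    calc |W φ| ≤ _ := htri
      _ ≤ g * |(1 / 2 : ℝ) ^ 4 - 1| * E + |κ| * |(1 / 2 : ℝ) ^ 2 - 1| * E +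
          |J| * |(1 / 2 : ℝ) - 1| * (Fintype.card V * E) := add_le_add (add_le_add hA hB) hC
      _ = _ := by ring
  have hWμ : Integrable W μ := integrable_phi4Measure_of_abs_le G hg κ J hWcont hWbound
  -- Lebesgue-level integrability of `(1 - W) e^{-S}` and `W e^{-S}`
  have htilt : ∀ {F : (V → ℝ) → ℝ}, Integrable F μ →
      Integrable (fun φ : V → ℝ => F φ * Real.exp (-S φ)) := by
    intro F hF
    rw [hμ, phi4Measure, integrable_tilted_iff (integrable_exp_neg_phi4Action G hg κ J)] at hF
    refine hF.congr (Eventually.of_forall fun φ => ?_)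
    simp only [smul_eq_mul, hS]
    ring
  have hint1 : Integrable (fun φ : V → ℝ => (1 - W φ) * Real.exp (-S φ)) :=
    htilt ((integrable_const (1 : ℝ)).sub hWμ)
  have hWS : Integrable (fun φ : V → ℝ => W φ * Real.exp (-S φ)) := htilt hWμ
  have hint2 := integrable_exp_neg_dilation G hg κ J (by norm_num : (0 : ℝ) < 1 / 2) x
  -- `∫ (1 - W) e^{-S} ≤ ∫ e^{-S ∘ T} = 2 Z`
  have hle : ∫ φ : V → ℝ, (1 - W φ) * Real.exp (-S φ) ≤
      ∫ φ : V → ℝ, Real.exp (-S (Function.update φ x ((1 / 2 : ℝ) * φ x))) := by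
    refine integral_mono hint1 hint2 fun φ => ?_
    simp only
    rw [hSW φ, neg_add, Real.exp_add, mul_comm (Real.exp (-S φ))]
    refine mul_le_mul_of_nonneg_right ?_ (Real.exp_nonneg _)
    have := Real.add_one_le_exp (-W φ)
    linarith
  rw [integral_exp_neg_dilation G g κ J (by norm_num : (0 : ℝ) < 1 / 2) x] at hle
  have hsplit : ∫ φ : V → ℝ, (1 - W φ) * Real.exp (-S φ) = Z - ∫ φ, W φ * Real.exp (-S φ) := by
    have hfun : (fun φ : V → ℝ => (1 - W φ) * Real.exp (-S φ)) =
        fun φ => Real.exp (-S φ) - W φ * Real.exp (-S φ) := by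
      funext φ; ring
    rw [hfun, integral_sub (integrable_exp_neg_phi4Action G hg κ J) hWS]
  rw [hsplit] at hle
  -- hence `⟨W⟩ ≥ -1`
  have hWavg : -1 ≤ ∫ φ, W φ ∂μ := by
    rw [hμ, integral_phi4Measure, ← hS, le_div_iff₀ hZpos]
    norm_num at hle ⊢
    linarith
  -- expand `⟨W⟩` by linearity
  have hI4 : Integrable (fun φ : V → ℝ => φ x ^ 4) μ := by
    simpa using integrable_pow_mul_pow_phi4Measure G hg κ J x x 4 0
  have hI2 : Integrable (fun φ : V → ℝ => φ x ^ 2) μ := by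
    simpa using integrable_pow_mul_pow_phi4Measure G hg κ J x x 2 0
  have hIxy : ∀ y, Integrable (fun φ : V → ℝ => φ x * φ y) μ := fun y => by
    simpa using integrable_pow_mul_pow_phi4Measure G hg κ J x y 1 1
  have hIsum : Integrable (fun φ : V → ℝ => φ x * ∑ y ∈ N, φ y) μ := by
    have : (fun φ : V → ℝ => φ x * ∑ y ∈ N, φ y) = fun φ => ∑ y ∈ N, φ x * φ y := by
      funext φ; rw [Finset.mul_sum]
    rw [this]
    exact integrable_finsetSum _ fun y _ => hIxy y
  have hWexp : ∫ φ, W φ ∂μ = g * ((1 / 2 : ℝ) ^ 4 - 1) * ∫ φ, φ x ^ 4 ∂μ +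
      κ * ((1 / 2 : ℝ) ^ 2 - 1) * ∫ φ, φ x ^ 2 ∂μ -
        J * ((1 / 2 : ℝ) - 1) * ∑ y ∈ N, ∫ φ, φ x * φ y ∂μ := by
    have hA : Integrable (fun φ : V → ℝ => g * ((1 / 2 : ℝ) ^ 4 - 1) * φ x ^ 4 +
        κ * ((1 / 2 : ℝ) ^ 2 - 1) * φ x ^ 2) μ := (hI4.const_mul _).add (hI2.const_mul _)
    have hB : Integrable (fun φ : V → ℝ => J * ((1 / 2 : ℝ) - 1) * (φ x * ∑ y ∈ N, φ y)) μ :=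
      hIsum.const_mul _
    simp only [hW]
    rw [integral_sub hA hB, integral_add (hI4.const_mul _) (hI2.const_mul _), integral_const_mul,
      integral_const_mul, integral_const_mul]
    congr 1
    have : (fun φ : V → ℝ => φ x * ∑ y ∈ N, φ y) = fun φ => ∑ y ∈ N, φ x * φ y := by
      funext φ; rw [Finset.mul_sum]
    rw [this, integral_finsetSum _ fun y _ => hIxy y]
  rw [hWexp] at hWavg
  norm_num at hWavg ⊢
  linarith

omit [DecidableEq V] in
/-- `⟨φₓ φ_y⟩ ≤ ½(⟨φₓ²⟩ + ⟨φ_y²⟩)` (pointwise AM–GM). [folklore] -/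
theorem phi4_twoPoint_le_half_add {g : ℝ} (hg : 0 < g) (κ J : ℝ) (x y : V) :
    ∫ φ, φ x * φ y ∂(phi4Measure G g κ J) ≤
      (∫ φ, φ x ^ 2 ∂(phi4Measure G g κ J) + ∫ φ, φ y ^ 2 ∂(phi4Measure G g κ J)) / 2 := by
  have hI2 : ∀ z, Integrable (fun φ : V → ℝ => φ z ^ 2) (phi4Measure G g κ J) := fun z => by
    simpa using integrable_pow_mul_pow_phi4Measure G hg κ J z z 2 0
  have hIxy : Integrable (fun φ : V → ℝ => φ x * φ y) (phi4Measure G g κ J) := by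
    simpa using integrable_pow_mul_pow_phi4Measure G hg κ J x y 1 1
  rw [le_div_iff₀ (by norm_num : (0 : ℝ) < 2), ← integral_add (hI2 x) (hI2 y), ← integral_mul_const]
  exact integral_mono (hIxy.mul_const _) ((hI2 x).add (hI2 y)) fun φ => by
    nlinarith [sq_nonneg (φ x - φ y)]

/-- **A-priori bound on `⟨φₓ²⟩`, uniform in the graph**: on a finite graph all of whose degrees
are `≤ Δ`, for `g > 0`, `J ≥ 0` and every vertex `x`,
`⟨φₓ²⟩_{G;g,κ,J} ≤ max 1 (16 (1 + |κ| + J Δ) / (15 g))`. [folklore] -/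
theorem phi4_sq_moment_le {g : ℝ} (hg : 0 < g) (κ : ℝ) {J : ℝ} (hJ : 0 ≤ J) {Δ : ℕ}
    (hΔ : ∀ x : V, (Finset.univ.filter (G.Adj x)).card ≤ Δ) (x : V) :
    ∫ φ, φ x ^ 2 ∂(phi4Measure G g κ J) ≤ max 1 (16 * (1 + |κ| + J * Δ) / (15 * g)) := by
  set μ := phi4Measure G g κ J with hμ
  set f : V → ℝ := fun y => ∫ φ, φ y ^ 2 ∂μ with hf
  obtain ⟨x₀, -, hx₀⟩ := Finset.exists_max_image Finset.univ f ⟨x, Finset.mem_univ x⟩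
  have hfm : ∀ y, f y ≤ f x₀ := fun y => hx₀ y (Finset.mem_univ y)
  have hf0 : ∀ y, 0 ≤ f y := fun y => integral_nonneg fun φ => sq_nonneg (φ y)
  have hm0 : 0 ≤ f x₀ := hf0 x₀
  refine (hfm x).trans ?_
  -- the equation of motion at `x₀`, Cauchy–Schwarz, and the neighbour bound
  have h4 := phi4_pow_four_moment_le G hg κ J x₀
  have hCS := sq_integral_sq_le_integral_pow_four G hg κ J x₀
  have hnb : ∑ y ∈ Finset.univ.filter (G.Adj x₀), ∫ φ, φ x₀ * φ y ∂μ ≤ Δ * f x₀ := by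
    refine (Finset.sum_le_sum (g := fun _ => f x₀) fun y _ => ?_).trans ?_
    · refine (phi4_twoPoint_le_half_add G hg κ J x₀ y).trans ?_
      have := hfm y
      simp only [hf] at this ⊢
      linarith
    · rw [Finset.sum_const, nsmul_eq_mul]
      exact mul_le_mul_of_nonneg_right (by exact_mod_cast hΔ x₀) hm0
  have hκ : -(3 / 4 * κ * f x₀) ≤ 3 / 4 * |κ| * f x₀ := by
    have h2 := neg_abs_le κ
    nlinarith [hm0]
  change 15 / 16 * g * ∫ φ, φ x₀ ^ 4 ∂μ ≤ 1 - 3 / 4 * κ * f x₀ +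
    J / 2 * ∑ y ∈ Finset.univ.filter (G.Adj x₀), ∫ φ, φ x₀ * φ y ∂μ at h4
  change f x₀ ^ 2 ≤ ∫ φ, φ x₀ ^ 4 ∂μ at hCS
  have hJ2 : J / 2 * ∑ y ∈ Finset.univ.filter (G.Adj x₀), ∫ φ, φ x₀ * φ y ∂μ ≤
      J / 2 * (Δ * f x₀) := mul_le_mul_of_nonneg_left hnb (by linarith)
  have hmain : 15 / 16 * g * f x₀ ^ 2 ≤ 1 + (|κ| + J * Δ) * f x₀ := by
    have h5 : 15 / 16 * g * f x₀ ^ 2 ≤ 15 / 16 * g * ∫ φ, φ x₀ ^ 4 ∂μ :=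
      mul_le_mul_of_nonneg_left hCS (by positivity)
    nlinarith [h4, hJ2, hκ, h5, mul_nonneg (abs_nonneg κ) hm0,
      mul_nonneg (mul_nonneg hJ (Nat.cast_nonneg Δ)) hm0]
  set m := f x₀ with hm
  rcases le_or_gt m 1 with hm1 | hm1
  · exact hm1.trans (le_max_left _ _)
  · refine le_trans ?_ (le_max_right _ _)
    rw [le_div_iff₀ (by linarith)]
    have h1 : 1 + (|κ| + J * Δ) * m ≤ (1 + |κ| + J * Δ) * m := by nlinarith [abs_nonneg κ]
    have h2 : 15 / 16 * g * m ^ 2 ≤ (1 + |κ| + J * Δ) * m := hmain.trans h1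
    have h3 : 15 / 16 * g * m ≤ 1 + |κ| + J * Δ := by
      refine le_of_mul_le_mul_right ?_ (by linarith : (0 : ℝ) < m)
      calc 15 / 16 * g * m * m = 15 / 16 * g * m ^ 2 := by ring
        _ ≤ _ := h2
    nlinarith [h3]

/-- **A-priori bound on the two-point function**:
`⟨φₓ φ_y⟩_{G;g,κ,J} ≤ max 1 (16 (1 + |κ| + J Δ) / (15 g))` for `g > 0`, `J ≥ 0` on a graph with
degrees `≤ Δ`. [folklore] -/
theorem phi4_twoPoint_le_bound {g : ℝ} (hg : 0 < g) (κ : ℝ) {J : ℝ} (hJ : 0 ≤ J) {Δ : ℕ}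
    (hΔ : ∀ x : V, (Finset.univ.filter (G.Adj x)).card ≤ Δ) (x y : V) :
    ∫ φ, φ x * φ y ∂(phi4Measure G g κ J) ≤ max 1 (16 * (1 + |κ| + J * Δ) / (15 * g)) := by
  refine (phi4_twoPoint_le_half_add G hg κ J x y).trans ?_
  have hx := phi4_sq_moment_le G hg κ hJ hΔ x
  have hy := phi4_sq_moment_le G hg κ hJ hΔ y
  linarith

end APriori

/-! ### 3. Monotonicity in the volume -/

section Iso

variable {V V' : Type*} [Fintype V] [Fintype V'] (G : SimpleGraph V) (G' : SimpleGraph V')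
  [DecidableRel G.Adj] [DecidableRel G'.Adj]

/-- The pair interaction is invariant under graph isomorphisms:
`∑_{E(G')} ψψ = ∑_{E(G)} (ψ∘e)(ψ∘e)`. [folklore] -/
theorem pairInteraction_comp_iso (e : G ≃g G') (ψ : V' → ℝ) :
    pairInteraction G' ψ = pairInteraction G (fun u => ψ (e u)) := by
  classical
  rw [pairInteraction_eq_half_sum_adj, pairInteraction_eq_half_sum_adj]
  congr 1
  symm
  refine Fintype.sum_equiv e.toEquiv _ _ fun u => ?_
  refine Fintype.sum_equiv e.toEquiv _ _ fun v => ?_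
  simp only [RelIso.coe_fn_toEquiv, e.map_rel_iff]

/-- The `φ⁴` action is invariant under graph isomorphisms. [folklore] -/
theorem phi4Action_comp_iso (e : G ≃g G') (g κ J : ℝ) (ψ : V' → ℝ) :
    phi4Action G' g κ J ψ = phi4Action G g κ J (fun u => ψ (e u)) := by
  unfold phi4Action
  rw [pairInteraction_comp_iso G G' e]
  congr 1
  symm
  exact Fintype.sum_equiv e.toEquiv _ _ fun u => by simp only [RelIso.coe_fn_toEquiv]

/-- **Expectations of the lattice `φ⁴` measure are invariant under graph isomorphisms**
(relabelling the sites: Lebesgue measure and the action are invariant). [folklore] -/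
theorem integral_phi4Measure_iso (e : G ≃g G') (g κ J : ℝ) (F : (V → ℝ) → ℝ) :
    ∫ ψ, F (fun u => ψ (e u)) ∂(phi4Measure G' g κ J) = ∫ φ, F φ ∂(phi4Measure G g κ J) := by
  rw [integral_phi4Measure, integral_phi4Measure,
    ← integral_comp_equiv_index e.toEquiv (fun φ : V → ℝ => F φ * Real.exp (-phi4Action G g κ J φ)),
    ← integral_comp_equiv_index e.toEquiv (fun φ : V → ℝ => Real.exp (-phi4Action G g κ J φ))]
  simp only [RelIso.coe_fn_toEquiv, ← phi4Action_comp_iso G G' e]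

/-- In particular the two-point function: `⟨ψ_{e a} ψ_{e b}⟩_{G'} = ⟨φ_a φ_b⟩_G`. [folklore] -/
theorem phi4_twoPoint_iso (e : G ≃g G') (g κ J : ℝ) (a b : V) :
    ∫ ψ, ψ (e a) * ψ (e b) ∂(phi4Measure G' g κ J) = ∫ φ, φ a * φ b ∂(phi4Measure G g κ J) :=
  integral_phi4Measure_iso G G' e g κ J fun φ => φ a * φ b

end Iso

section Decouple

variable {V : Type*} [Fintype V] (G : SimpleGraph V) [DecidableRel G.Adj]
  (p : V → Prop) [DecidablePred p]

/-- If no edge of `G` leaves `{u | p u}`, the pair interaction only involves those sites: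
`∑_{E(G)} φφ = ∑_{E(G|_{p})} (φ|_p)(φ|_p)`. [folklore] -/
theorem pairInteraction_eq_comap_subtype (hG : ∀ u v, G.Adj u v → p u ∧ p v) (φ : V → ℝ) :
    pairInteraction G φ =
      pairInteraction (G.comap (Subtype.val : {u // p u} → V)) (fun u => φ u) := by
  classical
  rw [pairInteraction_eq_half_sum_adj, pairInteraction_eq_half_sum_adj]
  congr 1
  have hout : ∀ u, ¬p u → ∀ v, (if G.Adj u v then φ u * φ v else 0) = 0 := by
    intro u hu v
    rw [if_neg]
    exact fun h => hu (hG u v h).1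
  have hout' : ∀ v, ¬p v → ∀ u, (if G.Adj u v then φ u * φ v else 0) = 0 := by
    intro v hv u
    rw [if_neg]
    exact fun h => hv (hG u v h).2
  rw [← Fintype.sum_subtype_add_sum_subtype p (fun u => ∑ v, if G.Adj u v then φ u * φ v else 0)]
  rw [Fintype.sum_eq_zero (fun c : {u // ¬p u} => ∑ v, if G.Adj c v then φ c * φ v else 0)
    (fun c => Finset.sum_eq_zero fun v _ => hout c c.2 v), add_zero]
  refine Finset.sum_congr rfl fun a _ => ?_
  rw [← Fintype.sum_subtype_add_sum_subtype p (fun v => if G.Adj a v then φ a * φ v else 0)]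
  rw [Fintype.sum_eq_zero (fun c : {u // ¬p u} => if G.Adj a c then φ a * φ c else 0)
    (fun c => hout' c c.2 a), add_zero]
  rfl

/-- Splitting the `φ⁴` action over `{p} ⊔ {¬p}` when no edge leaves `{p}`:
`S_G(φ) = S_{G|_p}(φ|_p) + ∑_{¬p} (g φ⁴ + κ φ²)`, the second term being the action of the empty
graph on `{¬p}`. [folklore] -/
theorem phi4Action_eq_comap_subtype_add (hG : ∀ u v, G.Adj u v → p u ∧ p v) (g κ J : ℝ)
    (φ : V → ℝ) :
    phi4Action G g κ J φ =
      phi4Action (G.comap (Subtype.val : {u // p u} → V)) g κ J (fun u => φ u) +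
        phi4Action (⊥ : SimpleGraph {u // ¬p u}) g κ J (fun u => φ u) := by
  have hbot : pairInteraction (⊥ : SimpleGraph {u // ¬p u}) (fun u => φ u) = 0 := by
    rw [pairInteraction_eq_half_sum_adj]
    simp
  unfold phi4Action
  rw [hbot, mul_zero, sub_zero, pairInteraction_eq_comap_subtype G p hG,
    ← Fintype.sum_subtype_add_sum_subtype p (fun u => g * φ u ^ 4 + κ * φ u ^ 2)]
  ring

/-- **Decoupled sites factor off**: if no edge of `G` leaves `{u | p u}`, the two-point function of
sites in `{p}` under `μ_G` equals that of the induced graph on `{p}` (Fubini: the a priori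
integrals over the sites in `{¬p}` cancel between numerator and partition function). [folklore] -/
theorem phi4_twoPoint_eq_comap_subtype (hG : ∀ u v, G.Adj u v → p u ∧ p v) {g : ℝ} (hg : 0 < g)
    (κ J : ℝ) (a b : {u // p u}) :
    ∫ φ, φ a * φ b ∂(phi4Measure G g κ J) =
      ∫ ψ, ψ a * ψ b ∂(phi4Measure (G.comap (Subtype.val : {u // p u} → V)) g κ J) := by
  set GA := G.comap (Subtype.val : {u // p u} → V) with hGA
  set K := ∫ χ : {u // ¬p u} → ℝ, Real.exp (-phi4Action (⊥ : SimpleGraph {u // ¬p u}) g κ J χ)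
    with hK
  have hKpos : 0 < K := phi4_partitionFunction_pos _ hg κ J
  have hsplit : ∀ F : ({u // p u} → ℝ) → ℝ,
      ∫ φ : V → ℝ, F (fun u => φ u) * Real.exp (-phi4Action G g κ J φ) =
        (∫ ψ : {u // p u} → ℝ, F ψ * Real.exp (-phi4Action GA g κ J ψ)) * K := by
    intro F
    rw [hK, ← integral_pi_mul_split p (fun ψ => F ψ * Real.exp (-phi4Action GA g κ J ψ))
      (fun χ => Real.exp (-phi4Action (⊥ : SimpleGraph {u // ¬p u}) g κ J χ))]
    refine integral_congr_ae (Eventually.of_forall fun φ => ?_)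
    simp only
    rw [phi4Action_eq_comap_subtype_add G p hG g κ J φ, neg_add, Real.exp_add]
    ring
  rw [integral_phi4Measure, integral_phi4Measure]
  have h1 := hsplit fun ψ => ψ a * ψ b
  have h2 := hsplit fun _ => 1
  simp only [one_mul] at h2
  simp only at h1
  rw [h1, h2, mul_div_mul_right _ _ hKpos.ne']

end Decouple

section Edges

variable {V : Type*} [Fintype V] [DecidableEq V] (G₀ G : SimpleGraph V)
  [DecidableRel G₀.Adj] [DecidableRel G.Adj]

/-- **Adding ferromagnetic bonds increases the two-point function** (Glimm–Jaffe 1987,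
Prop. 4.2.1, monotonicity in the couplings, applied to the couplings of the extra edges): for
`G₀ ≤ G` on the same sites, `g > 0`, `J ≥ 0`, `⟨φ_a φ_b⟩_{G₀} ≤ ⟨φ_a φ_b⟩_{G}`.
[cite: GlimmJaffeQP1987, Prop. 4.2.1 (p. 57)] -/
theorem phi4_twoPoint_mono_edges (hle : G₀ ≤ G) {g : ℝ} (hg : 0 < g) (κ : ℝ) {J : ℝ}
    (hJ : 0 ≤ J) (a b : V) :
    ∫ φ, φ a * φ b ∂(phi4Measure G₀ g κ J) ≤ ∫ φ, φ a * φ b ∂(phi4Measure G g κ J) := by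
  -- the extra couplings as a ferromagnetic polynomial
  set D : MvPolynomial V ℝ := (J / 2) • ∑ u, ∑ v,
    (if G.Adj u v ∧ ¬G₀.Adj u v then X u * X v else 0) with hD
  have hDf : IsFerromagnetic D := by
    refine IsFerromagnetic.smul (by linarith) (IsFerromagnetic.sum _ fun u _ =>
      IsFerromagnetic.sum _ fun v _ => ?_)
    split_ifs
    · exact (IsFerromagnetic.X u).mul (IsFerromagnetic.X v)
    · exact IsFerromagnetic.zero
  have hevalD : ∀ φ : V → ℝ, eval φ D =
      J / 2 * ∑ u, ∑ v, if G.Adj u v ∧ ¬G₀.Adj u v then φ u * φ v else 0 := by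
    intro φ
    simp only [hD, smul_eval, map_sum]
    congr 1
    refine Finset.sum_congr rfl fun u _ => Finset.sum_congr rfl fun v _ => ?_
    split_ifs <;> simp
  have hDq : HasQuadraticGrowth D := by
    refine ⟨J / 2 * Fintype.card V, by positivity, fun x hx => ?_⟩
    rw [hevalD]
    have h1 : ∑ u, ∑ v, (if G.Adj u v ∧ ¬G₀.Adj u v then x u * x v else 0) ≤
        ∑ u, ∑ v, x u * x v :=
      Finset.sum_le_sum fun u _ => Finset.sum_le_sum fun v _ => by
        split_ifs
        · exact le_rfl
        · exact mul_nonneg (hx u) (hx v)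
    have h2 : ∑ u, ∑ v, x u * x v ≤ Fintype.card V * ∑ u, x u ^ 2 := by
      calc ∑ u, ∑ v, x u * x v ≤ ∑ u, ∑ v, (x u ^ 2 + x v ^ 2) / 2 :=
            Finset.sum_le_sum fun u _ => Finset.sum_le_sum fun v _ => by
              nlinarith [sq_nonneg (x u - x v)]
        _ = Fintype.card V * ∑ u, x u ^ 2 := by
            have hin : ∀ u, ∑ v, (x u ^ 2 + x v ^ 2) / 2 =
                (Fintype.card V * x u ^ 2 + ∑ v, x v ^ 2) / 2 := by
              intro u
              rw [← Finset.sum_div, Finset.sum_add_distrib, Finset.sum_const, Finset.card_univ,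
                nsmul_eq_mul]
            simp_rw [hin]
            rw [← Finset.sum_div, Finset.sum_add_distrib, Finset.sum_const, Finset.card_univ,
              nsmul_eq_mul, ← Finset.mul_sum]
            ring
    have h4 : (0 : ℝ) ≤ ∑ u, x u ^ 2 := Finset.sum_nonneg fun u _ => sq_nonneg (x u)
    rw [mul_assoc]
    refine mul_le_mul_of_nonneg_left ?_ (by linarith)
    nlinarith [h1, h2, h4]
  -- `H + D` evaluates to the full interaction
  have hsum : ∀ φ : V → ℝ, eval φ (J • pairPoly G₀ + D) = J * pairInteraction G φ := by
    intro φ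
    rw [map_add, smul_eval, eval_pairPoly, hevalD, pairInteraction_eq_half_sum_adj,
      pairInteraction_eq_half_sum_adj]
    have : ∀ u v, (if G₀.Adj u v then φ u * φ v else 0) +
        (if G.Adj u v ∧ ¬G₀.Adj u v then φ u * φ v else 0) =
        if G.Adj u v then φ u * φ v else 0 := by
      intro u v
      by_cases h0 : G₀.Adj u v
      · simp [h0, hle h0]
      · simp [h0]
    rw [show J * (1 / 2 * ∑ u, ∑ v, if G₀.Adj u v then φ u * φ v else 0) +
        J / 2 * ∑ u, ∑ v, (if G.Adj u v ∧ ¬G₀.Adj u v then φ u * φ v else 0) =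
        J / 2 * ∑ u, ∑ v, ((if G₀.Adj u v then φ u * φ v else 0) +
          (if G.Adj u v ∧ ¬G₀.Adj u v then φ u * φ v else 0)) by
      simp only [Finset.sum_add_distrib]; ring]
    simp_rw [this]
    ring
  have hB0 : ∀ φ : V → ℝ, boltzWeight (phi4Potential g κ) (J • pairPoly G₀) φ =
      Real.exp (-phi4Action G₀ g κ J φ) := boltzWeight_phi4 G₀ g κ J
  have hB1 : ∀ φ : V → ℝ, boltzWeight (phi4Potential g κ) (J • pairPoly G₀ + D) φ =
      Real.exp (-phi4Action G g κ J φ) := by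
    intro φ
    rw [boltzWeight, hsum, ← Real.exp_add]
    congr 1
    simp only [phi4Action, phi4Potential]
    ring
  have h := griffiths_mono (isEvenSitePotential_phi4 hg κ) ((isFerromagnetic_pairPoly G₀).smul hJ)
    ((hasQuadraticGrowth_pairPoly G₀).smul hJ) hDf hDq
    ((IsFerromagnetic.X a).mul (IsFerromagnetic.X (σ := V) b))
  simp only [map_mul, eval_X, hB0, hB1] at h
  rw [integral_phi4Measure, integral_phi4Measure,
    div_le_div_iff₀ (phi4_partitionFunction_pos G₀ hg κ J) (phi4_partitionFunction_pos G hg κ J)]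
  exact h

end Edges

section ZdVolume

variable (d : ℕ)

/-- **Monotonicity of the free-boundary `φ⁴` two-point function in the volume** (Glimm–Jaffe
1987, §4.2: by Prop. 4.2.1 adding the bonds of `Λ' ∖ Λ` increases correlations, the uncoupled
sites of `Λ' ∖ Λ` factoring off; Friedli–Velenik 2017, Exercise 3.12 for Ising): for `Λ ⊆ Λ'`,
`g > 0`, `J ≥ 0`, `⟨φₓ φ_y⟩_{Λ; g,κ,J} ≤ ⟨φₓ φ_y⟩_{Λ'; g,κ,J}`. [cite: GlimmJaffeQP1987, Prop. 4.2.1 (p. 57)] -/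
theorem phi4TwoPointIn_mono_volume {Λ Λ' : Finset (Site d)} (hΛ : Λ ⊆ Λ') {g : ℝ} (hg : 0 < g)
    (κ : ℝ) {J : ℝ} (hJ : 0 ≤ J) (x y : Site d) :
    phi4TwoPointIn d Λ g κ J x y ≤ phi4TwoPointIn d Λ' g κ J x y := by
  classical
  by_cases hx : x ∈ Λ
  swap
  · rw [phi4TwoPointIn_eq_zero_of_not_mem d Λ g κ J (Or.inl hx)]
    exact phi4TwoPointIn_nonneg d Λ' hg κ hJ x y
  by_cases hy : y ∈ Λ
  swap
  · rw [phi4TwoPointIn_eq_zero_of_not_mem d Λ g κ J (Or.inr hy)]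
    exact phi4TwoPointIn_nonneg d Λ' hg κ hJ x y
  -- the graph on `Λ'` keeping only the bonds inside `Λ`
  let p : Λ' → Prop := fun u => (u : Site d) ∈ Λ
  let G₀ : SimpleGraph Λ' :=
    { Adj := fun u v => (zdGraph d).Adj u v ∧ (u : Site d) ∈ Λ ∧ (v : Site d) ∈ Λ
      symm := ⟨fun u v h => ⟨h.1.symm, h.2.2, h.2.1⟩⟩
      loopless := ⟨fun u h => (zdGraph d).loopless.1 u h.1⟩ }
  haveI : DecidableRel G₀.Adj := fun u v =>
    inferInstanceAs (Decidable ((zdGraph d).Adj u v ∧ (u : Site d) ∈ Λ ∧ (v : Site d) ∈ Λ))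
  have hle : G₀ ≤ zdGraphIn d Λ' := fun u v h => h.1
  have hin : ∀ u v, G₀.Adj u v → p u ∧ p v := fun u v h => ⟨h.2.1, h.2.2⟩
  -- `zdGraphIn d Λ ≃g G₀|_{p}`
  let e : zdGraphIn d Λ ≃g G₀.comap (Subtype.val : {u : Λ' // p u} → Λ') :=
    { toFun := fun z => ⟨⟨z.1, hΛ z.2⟩, z.2⟩
      invFun := fun u => ⟨u.1.1, u.2⟩
      left_inv := fun z => rfl
      right_inv := fun u => rfl
      map_rel_iff' := by
        intro z w
        change ((zdGraph d).Adj z w ∧ (z : Site d) ∈ Λ ∧ (w : Site d) ∈ Λ) ↔ (zdGraph d).Adj z w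
        exact ⟨fun h => h.1, fun h => ⟨h, z.2, w.2⟩⟩ }
  calc phi4TwoPointIn d Λ g κ J x y
      = ∫ ψ, ψ ⟨x, hx⟩ * ψ ⟨y, hy⟩ ∂(phi4Measure (zdGraphIn d Λ) g κ J) :=
        phi4TwoPointIn_eq_of_mem d Λ g κ J hx hy
    _ = ∫ χ, χ (e ⟨x, hx⟩) * χ (e ⟨y, hy⟩)
          ∂(phi4Measure (G₀.comap (Subtype.val : {u : Λ' // p u} → Λ')) g κ J) :=
        (phi4_twoPoint_iso _ _ e g κ J ⟨x, hx⟩ ⟨y, hy⟩).symm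
    _ = ∫ φ, φ ⟨x, hΛ hx⟩ * φ ⟨y, hΛ hy⟩ ∂(phi4Measure G₀ g κ J) :=
        (phi4_twoPoint_eq_comap_subtype G₀ p hin hg κ J ⟨⟨x, hΛ hx⟩, hx⟩ ⟨⟨y, hΛ hy⟩, hy⟩).symm
    _ ≤ ∫ φ, φ ⟨x, hΛ hx⟩ * φ ⟨y, hΛ hy⟩ ∂(phi4Measure (zdGraphIn d Λ') g κ J) :=
        phi4_twoPoint_mono_edges G₀ _ hle hg κ hJ _ _
    _ = phi4TwoPointIn d Λ' g κ J x y := (phi4TwoPointIn_eq_of_mem d Λ' g κ J (hΛ hx) (hΛ hy)).symm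

end ZdVolume

/-! ### 4. The thermodynamic limit of the two-point function -/

section Thermo

variable (d : ℕ)

/-- Every site of `ℤᵈ` has at most `2d` neighbours inside any finite volume (the neighbours of
`u` are among `u ± eᵢ`). [cite: FriedliVelenik2017, §3.1] -/
theorem card_filter_adj_zdGraphIn_le (Λ : Finset (Site d)) (u : Λ) :
    (Finset.univ.filter ((zdGraphIn d Λ).Adj u)).card ≤ 2 * d := by
  classical
  set t : Finset (Site d) := (Finset.univ : Finset (Fin d × Bool)).image
    fun q => if q.2 then Pi.single q.1 1 else -Pi.single q.1 1 with ht
  have hcard : t.card ≤ 2 * d := by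
    refine Finset.card_image_le.trans ?_
    simp [Finset.card_univ, mul_comm]
  refine le_trans ?_ hcard
  refine Finset.card_le_card_of_injOn (fun v : Λ => (v : Site d) - (u : Site d)) ?_ ?_
  · intro v hv
    rw [Finset.mem_coe, Finset.mem_filter] at hv
    obtain ⟨i, h | h⟩ := (zdGraph_adj_iff (u : Site d) v).1 hv.2
    · refine Finset.mem_coe.2 (Finset.mem_image.2 ⟨(i, true), Finset.mem_univ _, ?_⟩)
      simp [h]
    · refine Finset.mem_coe.2 (Finset.mem_image.2 ⟨(i, false), Finset.mem_univ _, ?_⟩)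
      simp [h]
  · intro v _ w _ hvw
    exact Subtype.ext (sub_left_inj.1 hvw)

/-- **Uniform bound on the free-boundary two-point function**:
`⟨φₓ φ_y⟩_{Λ; g,κ,J} ≤ max 1 (16 (1 + |κ| + 2dJ) / (15 g))` for all finite `Λ ⊂ ℤᵈ`, `g > 0`,
`J ≥ 0`. [folklore] -/
theorem phi4TwoPointIn_le_bound (Λ : Finset (Site d)) {g : ℝ} (hg : 0 < g) (κ : ℝ) {J : ℝ}
    (hJ : 0 ≤ J) (x y : Site d) :
    phi4TwoPointIn d Λ g κ J x y ≤ max 1 (16 * (1 + |κ| + J * (2 * d)) / (15 * g)) := by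
  by_cases hx : x ∈ Λ
  · by_cases hy : y ∈ Λ
    · rw [phi4TwoPointIn_eq_of_mem d Λ g κ J hx hy]
      have h := phi4_twoPoint_le_bound (zdGraphIn d Λ) hg κ hJ (Δ := 2 * d)
        (fun u => card_filter_adj_zdGraphIn_le d Λ u) ⟨x, hx⟩ ⟨y, hy⟩
      push_cast at h
      exact h
    · rw [phi4TwoPointIn_eq_zero_of_not_mem d Λ g κ J (Or.inr hy)]
      exact zero_le_one.trans (le_max_left _ _)
  · rw [phi4TwoPointIn_eq_zero_of_not_mem d Λ g κ J (Or.inl hx)]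
    exact zero_le_one.trans (le_max_left _ _)

/-- The finite-volume two-point functions are bounded above over all volumes. [folklore] -/
theorem bddAbove_range_phi4TwoPointIn {g : ℝ} (hg : 0 < g) (κ : ℝ) {J : ℝ} (hJ : 0 ≤ J)
    (x y : Site d) :
    BddAbove (Set.range fun Λ : Finset (Site d) => phi4TwoPointIn d Λ g κ J x y) :=
  ⟨_, by rintro _ ⟨Λ, rfl⟩; exact phi4TwoPointIn_le_bound d Λ hg κ hJ x y⟩

/-- `⟨φₓφ_y⟩_Λ ≤ ⨆_Λ' ⟨φₓφ_y⟩_{Λ'}`. [folklore] -/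
theorem phi4TwoPointIn_le_iSup (Λ : Finset (Site d)) {g : ℝ} (hg : 0 < g) (κ : ℝ) {J : ℝ}
    (hJ : 0 ≤ J) (x y : Site d) :
    phi4TwoPointIn d Λ g κ J x y ≤ ⨆ Λ' : Finset (Site d), phi4TwoPointIn d Λ' g κ J x y :=
  le_ciSup (bddAbove_range_phi4TwoPointIn d hg κ hJ x y) Λ

/-- `0 ≤ ⨆_Λ ⟨φₓφ_y⟩_Λ`. [folklore] -/
theorem iSup_phi4TwoPointIn_nonneg {g : ℝ} (hg : 0 < g) (κ : ℝ) {J : ℝ} (hJ : 0 ≤ J)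
    (x y : Site d) :
    0 ≤ ⨆ Λ : Finset (Site d), phi4TwoPointIn d Λ g κ J x y :=
  (phi4TwoPointIn_nonneg d ∅ hg κ hJ x y).trans (phi4TwoPointIn_le_iSup d ∅ hg κ hJ x y)

/-- `⨆_Λ ⟨φₓφ_y⟩_Λ ≤ max 1 (16 (1 + |κ| + 2dJ) / (15 g))`. [folklore] -/
theorem iSup_phi4TwoPointIn_le_bound {g : ℝ} (hg : 0 < g) (κ : ℝ) {J : ℝ} (hJ : 0 ≤ J)
    (x y : Site d) :
    (⨆ Λ : Finset (Site d), phi4TwoPointIn d Λ g κ J x y) ≤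
      max 1 (16 * (1 + |κ| + J * (2 * d)) / (15 * g)) :=
  ciSup_le fun Λ => phi4TwoPointIn_le_bound d Λ hg κ hJ x y

/-- **The thermodynamic limit along any increasing exhausting sequence of volumes**: the
free-boundary two-point functions converge to `⨆_Λ ⟨φₓφ_y⟩_Λ` (monotone and bounded).
(Glimm–Jaffe 1987, §4.2, use of Prop. 4.2.1; Friedli–Velenik 2017, §3.7.4 / Exercise 3.12 for
Ising.) [cite: GlimmJaffeQP1987, Prop. 4.2.1 (p. 57)] -/
theorem tendsto_phi4TwoPointIn_iSup {u : ℕ → Finset (Site d)} (hmono : Monotone u)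
    (hex : ∀ Λ : Finset (Site d), ∃ n, Λ ⊆ u n) {g : ℝ} (hg : 0 < g) (κ : ℝ) {J : ℝ}
    (hJ : 0 ≤ J) (x y : Site d) :
    Tendsto (fun n => phi4TwoPointIn d (u n) g κ J x y) atTop
      (𝓝 (⨆ Λ : Finset (Site d), phi4TwoPointIn d Λ g κ J x y)) := by
  have hmono' : Monotone fun n => phi4TwoPointIn d (u n) g κ J x y := fun m n hmn =>
    phi4TwoPointIn_mono_volume d (hmono hmn) hg κ hJ x y
  have hbdd : BddAbove (Set.range fun n => phi4TwoPointIn d (u n) g κ J x y) :=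
    ⟨_, by rintro _ ⟨n, rfl⟩; exact phi4TwoPointIn_le_bound d (u n) hg κ hJ x y⟩
  have h := tendsto_atTop_ciSup hmono' hbdd
  have heq : (⨆ n, phi4TwoPointIn d (u n) g κ J x y) =
      ⨆ Λ : Finset (Site d), phi4TwoPointIn d Λ g κ J x y := by
    apply le_antisymm
    · exact ciSup_le fun n => phi4TwoPointIn_le_iSup d (u n) hg κ hJ x y
    · refine ciSup_le fun Λ => ?_
      obtain ⟨n, hn⟩ := hex Λ
      exact (phi4TwoPointIn_mono_volume d hn hg κ hJ x y).trans (le_ciSup hbdd n)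
  rwa [heq] at h

/-- Every finite volume is contained in some box. [cite: FriedliVelenik2017, §3.2] -/
theorem exists_box_supset (Λ : Finset (Site d)) : ∃ R : ℕ, Λ ⊆ box d R := by
  refine ⟨Λ.sup fun x => Finset.univ.sup fun i => (x i).natAbs, fun x hx => ?_⟩
  rw [mem_box]
  intro i
  have h1 : (x i).natAbs ≤ Finset.univ.sup fun i => (x i).natAbs :=
    Finset.le_sup (f := fun i => (x i).natAbs) (Finset.mem_univ i)
  have h2 : (Finset.univ.sup fun i => (x i).natAbs) ≤
      Λ.sup fun x => Finset.univ.sup fun i => (x i).natAbs :=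
    Finset.le_sup (f := fun x : Site d => Finset.univ.sup fun i => (x i).natAbs) hx
  omega

/-- **The thermodynamic limit along boxes exists** and equals `⨆_Λ ⟨φₓφ_y⟩_Λ`, for every `g > 0`,
`κ`, `J ≥ 0`. [cite: GlimmJaffeQP1987, Prop. 4.2.1 (p. 57)] -/
theorem hasBoxLimit_phi4TwoPointIn {g : ℝ} (hg : 0 < g) (κ : ℝ) {J : ℝ} (hJ : 0 ≤ J)
    (x y : Site d) :
    HasBoxLimit (fun Λ => phi4TwoPointIn d Λ g κ J x y)
      (⨆ Λ : Finset (Site d), phi4TwoPointIn d Λ g κ J x y) :=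
  tendsto_phi4TwoPointIn_iSup d (box_mono d) (exists_box_supset d) hg κ hJ x y

/-- **The tree's infinite-volume two-point function is the supremum over finite volumes**:
`phi4TwoPoint d g κ J x = ⨆_Λ ⟨φ₀φₓ⟩_Λ` for `g > 0`, `J ≥ 0` (its docstring's "it exists for
`0 ≤ J` by the Griffiths inequalities"). [cite: FriedliVelenik2017, §3.7.4] -/
theorem phi4TwoPoint_eq_iSup {g : ℝ} (hg : 0 < g) (κ : ℝ) {J : ℝ} (hJ : 0 ≤ J) (x : Site d) :
    phi4TwoPoint d g κ J x = ⨆ Λ : Finset (Site d), phi4TwoPointIn d Λ g κ J 0 x :=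
  boxLim_eq_of_hasBoxLimit (hasBoxLimit_phi4TwoPointIn d hg κ hJ 0 x)

/-- `0 ≤ phi4TwoPoint d g κ J x ≤ max 1 (16 (1 + |κ| + 2dJ) / (15 g))`. [folklore] -/
theorem phi4TwoPoint_nonneg_and_le {g : ℝ} (hg : 0 < g) (κ : ℝ) {J : ℝ} (hJ : 0 ≤ J)
    (x : Site d) :
    0 ≤ phi4TwoPoint d g κ J x ∧
      phi4TwoPoint d g κ J x ≤ max 1 (16 * (1 + |κ| + J * (2 * d)) / (15 * g)) := by
  rw [phi4TwoPoint_eq_iSup d hg κ hJ x]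
  exact ⟨iSup_phi4TwoPointIn_nonneg d hg κ hJ 0 x, iSup_phi4TwoPointIn_le_bound d hg κ hJ 0 x⟩

end Thermo

/-! ### 5. Translation invariance -/

section Shift

variable (d : ℕ)

/-- Translating the volume and the sites does not change the free-boundary two-point function
(relabelling invariance of `phi4Measure` along the graph isomorphism `x ↦ x + v`). [folklore] -/
theorem phi4TwoPointIn_shift (Λ : Finset (Site d)) (v : Site d) (g κ J : ℝ) (x y : Site d) :
    phi4TwoPointIn d (Λ.map (Equiv.addRight v).toEmbedding) g κ J (x + v) (y + v) =
      phi4TwoPointIn d Λ g κ J x y := by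
  classical
  have hmem : ∀ z : Site d, z + v ∈ Λ.map (Equiv.addRight v).toEmbedding ↔ z ∈ Λ := by
    intro z
    rw [Finset.mem_map_equiv]
    simp
  by_cases hx : x ∈ Λ
  swap
  · rw [phi4TwoPointIn_eq_zero_of_not_mem d Λ g κ J (Or.inl hx),
      phi4TwoPointIn_eq_zero_of_not_mem d _ g κ J (Or.inl (mt (hmem x).1 hx))]
  by_cases hy : y ∈ Λ
  swap
  · rw [phi4TwoPointIn_eq_zero_of_not_mem d Λ g κ J (Or.inr hy),
      phi4TwoPointIn_eq_zero_of_not_mem d _ g κ J (Or.inr (mt (hmem y).1 hy))]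
  let e : zdGraphIn d Λ ≃g zdGraphIn d (Λ.map (Equiv.addRight v).toEmbedding) :=
    { toFun := fun z => ⟨z + v, (hmem z).2 z.2⟩
      invFun := fun w => ⟨w - v, (hmem _).1 (by simpa using w.2)⟩
      left_inv := fun z => by ext; simp
      right_inv := fun w => by ext; simp
      map_rel_iff' := by
        intro z w
        change (zdGraph d).Adj ((z : Site d) + v) ((w : Site d) + v) ↔ (zdGraph d).Adj z w
        exact zdGraph_adj_shift_iff v z w }
  rw [phi4TwoPointIn_eq_of_mem d Λ g κ J hx hy,
    phi4TwoPointIn_eq_of_mem d _ g κ J ((hmem x).2 hx) ((hmem y).2 hy),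
    ← phi4_twoPoint_iso _ _ e g κ J ⟨x, hx⟩ ⟨y, hy⟩]
  rfl

/-- **Translation invariance of the infinite-volume two-point function**:
`⨆_Λ ⟨φ_{x+v} φ_{y+v}⟩_Λ = ⨆_Λ ⟨φₓ φ_y⟩_Λ`. [cite: AizenmanDuminilCopinAnnals2021, §5 (p. 16: `S_{ρ,β}(x) = ⟨τ₀τₓ⟩_{ρ,β}`)] -/
theorem iSup_phi4TwoPointIn_shift (v : Site d) (g κ J : ℝ) (x y : Site d) :
    (⨆ Λ : Finset (Site d), phi4TwoPointIn d Λ g κ J (x + v) (y + v)) =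
      ⨆ Λ : Finset (Site d), phi4TwoPointIn d Λ g κ J x y := by
  have hsurj : Function.Surjective fun Λ : Finset (Site d) => Λ.map (Equiv.addRight v).toEmbedding := by
    intro Λ'
    refine ⟨Λ'.map (Equiv.addRight (-v)).toEmbedding, ?_⟩
    ext z
    simp only [Finset.map_map, Finset.mem_map, Function.Embedding.trans_apply,
      Equiv.coe_toEmbedding, Equiv.coe_addRight]
    constructor
    · rintro ⟨a, ha, rfl⟩
      simpa using ha
    · intro hz
      exact ⟨z, hz, by simp⟩
  rw [← hsurj.iSup_comp (fun Λ => phi4TwoPointIn d Λ g κ J (x + v) (y + v))]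
  simp only [phi4TwoPointIn_shift]

/-- In particular `⨆_Λ ⟨φₓ φ_y⟩_Λ = ⨆_Λ ⟨φ₀ φ_{y-x}⟩_Λ` (`= phi4TwoPoint d g κ J (y - x)` for
`g > 0`, `J ≥ 0`). [folklore] -/
theorem iSup_phi4TwoPointIn_eq_zero_sub (g κ J : ℝ) (x y : Site d) :
    (⨆ Λ : Finset (Site d), phi4TwoPointIn d Λ g κ J x y) =
      ⨆ Λ : Finset (Site d), phi4TwoPointIn d Λ g κ J 0 (y - x) := by
  have h := iSup_phi4TwoPointIn_shift d x g κ J 0 (y - x)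
  simp only [zero_add, sub_add_cancel] at h
  exact h

end Shift

end Literature.MathematicalPhysics.QuantumLattice
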